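import Mathlib

/-!
# Venture HSemireg — MOD-4 line: the sign-sensitive steps of THEOREM R_f's middle-degree proof, for every `n`
# (one-site products, MERGE LEMMA, SIGN LEMMA `μ_B·μ_{P∖B} = (−1)^{C(n,2)+|B|}·m_P`, `μ_B·η_p = [p = n−|B|]·κ·m_P`
# with `κ = (−1)^{C(n+1,2)}`, the degree-`n` commutation sign `(−1)^{n·n} = (−1)^n`, and the size reduction
# `dim ker(Z·K·Zᵀ − c) = dim ker(K·Zᵀ·Z − c)` for `c ≠ 0`)

HONEST FRAMING. Part of the Lean index of the computation cell `pub-hsemireg` (widening group W3, seat w3-mod4-1 gen 5;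
files of record `HOME/widen/W3/MOD4-OFFSPLIT-w3mod4.md` §10.2 and `MOD4-THEOREM-RF-PROOF-w3mod4.md` v1.0 §2 (P1), §4, §7).
EXTERIOR ALGEBRA OVER A COMMUTATIVE RING / LINEAR ALGEBRA OVER A FIELD ONLY: no abelian variety, no Hodge structure, no sheaf,
no Ext group and no semiregularity map is constructed here; nothing here says that HC, HC_CM or HC_AV holds; no Literature fact
is declared or used.  THEOREM R_f itself (the closed form of the contraction-rank table) is NOT asserted here: its side-degree
clauses are th-7's kernel theorems `Summit.Ventures.HSemireg.Wedge.Weil.weilRank_nn_deg` / `…WeilPurity.weilRank_nn_deg_dual` /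
`…Weil.weilRank_nn_one` (+ `Wedge.Hankel.hankelLaw_model` for `w = 0`), and its middle-degree clause is a pencil theorem
(×2 across seats, machine ×4 across codes) whose proof sheet names three places «where a slip would matter» (§7): (i) the
one-site products of §2 (P1), (ii) the SIGN LEMMA of §4 (the `B`-independence of the sign `κ_B`, which is what makes the
coupling matrix depend on subset SIZES only), (iii) the sign `(−1)^{n·n}` of commuting two degree-`n` words, plus the linear
algebra step «size reduction» `N = Z K Zᵀ ⇒ dim ker(N − λ) = dim ker(K D − λ)`, `D = ZᵀZ`, `λ ≠ 0`.  THIS FILE KERNEL-CHECKS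
EXACTLY THESE STEPS, for every `n`, in the generality «any letters `x_i, y_i` of any module over any commutative ring» (no linear
independence is needed for the sign identities) resp. «any pair of linear maps over a field»:
* §1 `ι_mul_prod_ofFn`, `prod_ofFn_mul_comm`, `neg_one_pow_mul_self` — moving a generator past an ordered product of `n`
  generators costs `(−1)^n`; two ordered products of lengths `n`, `m` commute up to `(−1)^{n·m}`; `(−1)^{n·n} = (−1)^n` (iii);
* §2 `merge_prod` — MERGE LEMMA: `(ℓ_0⋯ℓ_{n−1})·(ℓ′_0⋯ℓ′_{n−1}) = (−1)^{C(n,2)}·∏_i (ℓ_iℓ′_i)` for ANY `2n` vectors;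
* §3 `site_x`, `site_y`, `site_xy` — (i): `x(x − λy) = −λ·xy`, `y(x − λy) = −xy`, `(xy)(x − λy) = 0`;
* §4 `word_mul_word_compl` — SIGN LEMMA (ii): with `μ_B := ∏_i^{<} (y_i if i ∈ B else x_i)` and `m_P := ∏_i x_iy_i`,
  `μ_B·μ_{Bᶜ} = (−1)^{C(n,2)+|B|}·m_P`; `word_mul_word_eq_zero` — `μ_B·μ_T = 0` for `T ≠ Bᶜ` (a repeated letter);
  `word_mul_eta` — with `η_p := (−1)^p Σ_{|T|=p} μ_T` (the `λ^p`-coefficient of `∏_i(x_i − λy_i)`):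
  `μ_B·η_p = [p = n − |B|]·(−1)^{C(n+1,2)}·m_P`, i.e. `κ_B = (−1)^{n(n+1)/2}` for EVERY `B` (proof sheet §4, lines 3–6);
* §5 `finrank_ker_comp_sub_smul_comm`, `finrank_ker_ZKZt` — for linear maps `f : V → W`, `g : W → V` and
  `c ≠ 0`, `ker(fg − c) ≃ ker(gf − c)` (via `g`, inverse `c⁻¹f`); hence for matrices `dim ker(Z K Zᵀ − c) = dim ker(K (ZᵀZ) − c)`
  — the proof sheet's reduction of the `2ⁿ × 2ⁿ` block `N = Σ₂Σ₁` to the `(n+1) × (n+1)` matrix `M_f = K·D` (there `Z_{B′,a} =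
  [|B′| = a]`, `D = ZᵀZ = diag C(n,a)`: `transpose_sizeIndicator_mul`).  NO definitions are introduced: the words `μ_B`, `m_P`, `η_p`
are carried verbatim as `List.ofFn`-products in the statements (see the §4 header).
DICTIONARY (on paper, NOT asserted in Lean): `x_i = ι_i` (contraction with `∂/∂z_i`), `y_i = ε̄_i` (`dz̄_i ∧`), sites `i ∈ P`,
`Φ: ξ ↦ ξ(Ω₀)` the Gorenstein dictionary of MOD4-OFFSPLIT §10.1; the words `μ_B`, `η^P_p`, `m_P` are those of the proof sheet §4.
All statements and proofs: w3-mod4-1 g5 (2026-08-23).  Namespace `Summit.Ventures.HSemireg.Mod4Site`.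
-/

namespace Summit.Ventures.HSemireg.Mod4Site

open ExteriorAlgebra

/-! ### §1 Commutation signs for ordered products of generators -/

section Products

variable {R : Type*} [CommRing R] {M : Type*} [AddCommGroup M] [Module R M]

/-- two generators anticommute: `ι v · ι w = −ι w · ι v`. -/
theorem ι_mul_ι_eq_neg (v w : M) : ι R v * ι R w = -(ι R w * ι R v) :=
  eq_neg_of_add_eq_zero_left (ExteriorAlgebra.ι_add_mul_swap v w)

/-- moving one generator past an ordered product of `n` generators costs the sign `(−1)^n`. -/
theorem ι_mul_prod_ofFn (v : M) {n : ℕ} (l : Fin n → M) :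
    ι R v * (List.ofFn fun i => ι R (l i)).prod =
      ((-1 : R) ^ n) • ((List.ofFn fun i => ι R (l i)).prod * ι R v) := by
  induction n with
  | zero => simp
  | succ n ih =>
    rw [List.ofFn_succ, List.prod_cons, ← mul_assoc, ι_mul_ι_eq_neg, neg_mul, mul_assoc, ih (fun i => l i.succ),
      mul_smul_comm, pow_succ, mul_neg_one, neg_smul, mul_assoc]

/-- the same sign read from the other side: `(∏ l)·ι v = (−1)^n · ι v·(∏ l)`. -/
theorem prod_ofFn_mul_ι (v : M) {n : ℕ} (l : Fin n → M) :
    (List.ofFn fun i => ι R (l i)).prod * ι R v =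
      ((-1 : R) ^ n) • (ι R v * (List.ofFn fun i => ι R (l i)).prod) := by
  rw [ι_mul_prod_ofFn, smul_smul, ← pow_add, ← two_mul, pow_mul, neg_one_sq, one_pow, one_smul]

/-- ordered products of `n` and of `m` generators commute up to `(−1)^{n·m}` (graded commutativity, parity only). -/
theorem prod_ofFn_mul_comm {n m : ℕ} (l : Fin n → M) (l' : Fin m → M) :
    (List.ofFn fun i => ι R (l i)).prod * (List.ofFn fun j => ι R (l' j)).prod =
      ((-1 : R) ^ (n * m)) • ((List.ofFn fun j => ι R (l' j)).prod * (List.ofFn fun i => ι R (l i)).prod) := by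
  induction n with
  | zero => simp
  | succ n ih =>
    rw [List.ofFn_succ, List.prod_cons, mul_assoc, ih (fun i => l i.succ), mul_smul_comm, ← mul_assoc,
      ι_mul_prod_ofFn, smul_mul_assoc, smul_smul, ← pow_add, mul_assoc, Nat.succ_mul, add_comm]

/-- (iii) of the proof sheet §7: the sign of commuting two degree-`n` words is `(−1)^{n·n} = (−1)^n`. -/
theorem neg_one_pow_mul_self (n : ℕ) : ((-1 : R) ^ (n * n)) = (-1) ^ n := by
  rcases Nat.even_or_odd n with h | h
  · rw [h.neg_one_pow, (Nat.even_mul.mpr (Or.inl h)).neg_one_pow]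
  · rw [h.neg_one_pow, (Nat.odd_mul.mpr ⟨h, h⟩).neg_one_pow]

/-- two degree-`n` words commute up to `(−1)^n` (the `(−1)ⁿ` in `Σ₂` of the proof sheet §4). -/
theorem prod_ofFn_mul_comm_self {n : ℕ} (l l' : Fin n → M) :
    (List.ofFn fun i => ι R (l i)).prod * (List.ofFn fun j => ι R (l' j)).prod =
      ((-1 : R) ^ n) • ((List.ofFn fun j => ι R (l' j)).prod * (List.ofFn fun i => ι R (l i)).prod) := by
  rw [prod_ofFn_mul_comm, neg_one_pow_mul_self]

/-! ### §2 MERGE LEMMA -/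

/-- **MERGE LEMMA.** Merging two site-ordered words of the same length `n` into the ordered product of the site pairs costs
the `B`-INDEPENDENT sign `(−1)^{C(n,2)}` (`ℓ′_0` passes `ℓ_1 … ℓ_{n−1}`, `ℓ′_1` passes `ℓ_2 … ℓ_{n−1}`, …):
`(ℓ_0 ⋯ ℓ_{n−1})·(ℓ′_0 ⋯ ℓ′_{n−1}) = (−1)^{C(n,2)} · (ℓ_0ℓ′_0)(ℓ_1ℓ′_1)⋯(ℓ_{n−1}ℓ′_{n−1})`, for ANY vectors. -/
theorem merge_prod {n : ℕ} (l l' : Fin n → M) :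
    (List.ofFn fun i => ι R (l i)).prod * (List.ofFn fun i => ι R (l' i)).prod =
      ((-1 : R) ^ n.choose 2) • (List.ofFn fun i => ι R (l i) * ι R (l' i)).prod := by
  induction n with
  | zero => simp
  | succ n ih =>
    rw [List.ofFn_succ, List.prod_cons, List.ofFn_succ (f := fun i => ι R (l' i)), List.prod_cons,
      List.ofFn_succ (f := fun i => ι R (l i) * ι R (l' i)), List.prod_cons]
    have hA := prod_ofFn_mul_ι (R := R) (l' 0) (fun i : Fin n => l i.succ)
    calc ι R (l 0) * (List.ofFn fun i : Fin n => ι R (l i.succ)).prod *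
          (ι R (l' 0) * (List.ofFn fun i : Fin n => ι R (l' i.succ)).prod)
        = ι R (l 0) * ((List.ofFn fun i : Fin n => ι R (l i.succ)).prod * ι R (l' 0)) *
            (List.ofFn fun i : Fin n => ι R (l' i.succ)).prod := by simp only [mul_assoc]
      _ = ((-1 : R) ^ n) • (ι R (l 0) * ι R (l' 0) *
            ((List.ofFn fun i : Fin n => ι R (l i.succ)).prod *
              (List.ofFn fun i : Fin n => ι R (l' i.succ)).prod)) := by
          rw [hA, mul_smul_comm, smul_mul_assoc]; simp only [mul_assoc]
      _ = ((-1 : R) ^ (n + 1).choose 2) •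
            (ι R (l 0) * ι R (l' 0) * (List.ofFn fun i : Fin n => ι R (l i.succ) * ι R (l' i.succ)).prod) := by
          rw [ih (fun i => l i.succ) (fun i => l' i.succ), mul_smul_comm, smul_smul, ← pow_add,
            Nat.choose_succ_succ, Nat.choose_one_right]

/-- scalars pull out of an ordered product: `∏ (c_i • z_i) = (∏ c_i) • ∏ z_i` (in any algebra). -/
theorem prod_ofFn_smul {A : Type*} [Ring A] [Algebra R A] {n : ℕ} (c : Fin n → R) (z : Fin n → A) :
    (List.ofFn fun i => c i • z i).prod = (∏ i, c i) • (List.ofFn fun i => z i).prod := by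
  induction n with
  | zero => simp
  | succ n ih =>
    rw [List.ofFn_succ, List.prod_cons, ih (fun i => c i.succ) (fun i => z i.succ),
      List.ofFn_succ (f := fun i => z i), List.prod_cons, Fin.prod_univ_succ, smul_mul_assoc, mul_smul_comm, smul_smul]

/-! ### §3 One-site products (proof sheet §2 (P1)) -/

/-- `x·(x − λy) = −λ·(xy)`. -/
theorem site_x (u v : M) (c : R) : ι R u * (ι R u - c • ι R v) = -(c • (ι R u * ι R v)) := by
  rw [mul_sub, ExteriorAlgebra.ι_sq_zero, zero_sub, mul_smul_comm]

/-- `y·(x − λy) = yx = −xy`. -/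
theorem site_y (u v : M) (c : R) : ι R v * (ι R u - c • ι R v) = -(ι R u * ι R v) := by
  rw [mul_sub, mul_smul_comm, ExteriorAlgebra.ι_sq_zero, smul_zero, sub_zero, ι_mul_ι_eq_neg]

/-- `(xy)·(x − λy) = 0`. -/
theorem site_xy (u v : M) (c : R) : (ι R u * ι R v) * (ι R u - c • ι R v) = 0 := by
  rw [mul_sub, mul_smul_comm, mul_assoc, mul_assoc, ExteriorAlgebra.ι_sq_zero, mul_zero, smul_zero, sub_zero,
    ι_mul_ι_eq_neg v u, mul_neg, ← mul_assoc, ExteriorAlgebra.ι_sq_zero, zero_mul, neg_zero]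

end Products

/-! ### §4 The words `μ_B`, `m_P`, `η_p` on `n` sites and the SIGN LEMMA -/

section Words

variable {R : Type*} [CommRing R] {M : Type*} [AddCommGroup M] [Module R M] {n : ℕ} (x y : Fin n → M)

/-! Throughout: `μ_B := (List.ofFn fun i => ι R (if i ∈ B then y i else x i)).prod` is the site-ordered word with `y_i` at
the sites of `B ⊆ [n]` and `x_i` elsewhere; `m_P := (List.ofFn fun i => ι R (x i) * ι R (y i)).prod = ∏_i x_iy_i`;
`η_p := (−1)^p • Σ_{|T| = p} μ_T` (the `λ^p`-coefficient of `∏_i (x_i − λy_i)`).  No definitions are introduced (the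
statements carry these expressions verbatim). -/

/-- at one site: `ℓ_i ℓ′_i = x_iy_i` off `B` and `y_ix_i = −x_iy_i` on `B` (`Bᶜ` puts `x_i` on `B`, `y_i` off `B`). -/
lemma letter_mul_letter_compl (B : Finset (Fin n)) (i : Fin n) :
    ι R (if i ∈ B then y i else x i) * ι R (if i ∈ Bᶜ then y i else x i) =
      (if i ∈ B then (-1 : R) else 1) • (ι R (x i) * ι R (y i)) := by
  by_cases h : i ∈ B
  · rw [if_pos h, if_neg (fun hc => Finset.mem_compl.mp hc h), if_pos h, ι_mul_ι_eq_neg, neg_one_smul]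
  · rw [if_neg h, if_pos (Finset.mem_compl.mpr h), if_neg h, one_smul]

/-- `∏_i (−1 if i ∈ B else 1) = (−1)^{|B|}`. -/
lemma prod_sign_eq (B : Finset (Fin n)) : (∏ i : Fin n, (if i ∈ B then (-1 : R) else 1)) = (-1) ^ B.card := by
  rw [Finset.prod_ite, Finset.prod_const_one, mul_one, Finset.prod_const, Finset.filter_univ_mem]

/-- **SIGN LEMMA** (proof sheet §4; (ii) of §7): `μ_B · μ_{P∖B} = (−1)^{C(n,2) + |B|} · m_P` for every `B ⊆ P = [n]`
and every `n` — the merge sign `(−1)^{C(n,2)}` is `B`-independent and each site of `B` contributes one transposition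
`y_ix_i = −x_iy_i`.  Holds for arbitrary letters `x_i, y_i` (no independence assumed); `μ_{P∖B} = μ_{Bᶜ}`. -/
theorem word_mul_word_compl (B : Finset (Fin n)) :
    (List.ofFn fun i => ι R (if i ∈ B then y i else x i)).prod *
        (List.ofFn fun i => ι R (if i ∈ Bᶜ then y i else x i)).prod =
      ((-1 : R) ^ (n.choose 2 + B.card)) • (List.ofFn fun i => ι R (x i) * ι R (y i)).prod := by
  rw [merge_prod, funext (letter_mul_letter_compl (R := R) x y B), prod_ofFn_smul, prod_sign_eq, smul_smul, ← pow_add]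

/-- the concatenated letters of `μ_B · μ_T` as one alternating `2n`-fold product. -/
lemma word_mul_word_eq_ιMulti (B T : Finset (Fin n)) :
    (List.ofFn fun i => ι R (if i ∈ B then y i else x i)).prod *
        (List.ofFn fun i => ι R (if i ∈ T then y i else x i)).prod =
      ιMulti R (n + n) (Fin.append (fun i => if i ∈ B then y i else x i) (fun i => if i ∈ T then y i else x i)) := by
  rw [ιMulti_apply, show (fun i => ι R (Fin.append (fun i => if i ∈ B then y i else x i)
      (fun i => if i ∈ T then y i else x i) i)) =
      ι R ∘ Fin.append (fun i => if i ∈ B then y i else x i) (fun i => if i ∈ T then y i else x i) from rfl,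
    ← List.map_ofFn, List.ofFn_fin_append, List.map_append, List.prod_append, List.map_ofFn, List.map_ofFn]
  rfl

/-- `μ_B · μ_T = 0` unless `T = P ∖ B`: if `T ≠ Bᶜ` some site carries the same letter in both words (`y_i` twice if
`i ∈ B ∩ T`, `x_i` twice if `i ∉ B ∪ T`), and a product of generators with a repeated letter vanishes. -/
theorem word_mul_word_eq_zero {B T : Finset (Fin n)} (hT : T ≠ Bᶜ) :
    (List.ofFn fun i => ι R (if i ∈ B then y i else x i)).prod *
        (List.ofFn fun i => ι R (if i ∈ T then y i else x i)).prod = 0 := by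
  have h : ∃ i, (i ∈ T ↔ i ∈ B) := by
    by_contra hc
    apply hT
    ext i
    rw [Finset.mem_compl]
    have hi : ¬ (i ∈ T ↔ i ∈ B) := fun h => hc ⟨i, h⟩
    tauto
  obtain ⟨i, hi⟩ := h
  rw [word_mul_word_eq_ιMulti]
  refine AlternatingMap.map_eq_zero_of_eq _ _ (i := Fin.castAdd n i) (j := Fin.natAdd n i) ?_ ?_
  · rw [Fin.append_left, Fin.append_right]
    by_cases hb : i ∈ B
    · simp only [if_pos hb, if_pos (hi.mpr hb)]
    · simp only [if_neg hb, if_neg (fun h => hb (hi.mp h))]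
  · intro h
    have := congrArg Fin.val h
    simp only [Fin.val_castAdd, Fin.val_natAdd] at this
    omega

/-- **`κ_B` is `B`-independent** (proof sheet §4, the line before the SIGN LEMMA and its conclusion): with
`η_p := (−1)^p Σ_{|T|=p} μ_T`, `μ_B · η_p = [p = n − |B|] · κ · m_P` with `κ = (−1)^{n(n+1)/2} = (−1)^{C(n+1,2)}` for EVERY
`B` — only `T = P ∖ B` survives in `η_p`, with the sign `(−1)^{(n−|B|) + C(n,2) + |B|}`. -/
theorem word_mul_eta (B : Finset (Fin n)) (p : ℕ) :
    (List.ofFn fun i => ι R (if i ∈ B then y i else x i)).prod *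
        (((-1 : R) ^ p) • ∑ T ∈ (Finset.univ : Finset (Fin n)).powersetCard p,
          (List.ofFn fun i => ι R (if i ∈ T then y i else x i)).prod) =
      if p = n - B.card then ((-1 : R) ^ (n + 1).choose 2) • (List.ofFn fun i => ι R (x i) * ι R (y i)).prod
      else 0 := by
  rw [mul_smul_comm, Finset.mul_sum]
  have hBc : Bᶜ.card = n - B.card := by rw [Finset.card_compl, Fintype.card_fin]
  have hBn : B.card ≤ n := by simpa using Finset.card_le_univ B
  split_ifs with hp
  · rw [Finset.sum_eq_single_of_mem Bᶜ (by rw [Finset.mem_powersetCard]; exact ⟨Finset.subset_univ _, hBc ▸ hp.symm⟩)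
        (fun T _ hT => word_mul_word_eq_zero x y hT),
      word_mul_word_compl, smul_smul, ← pow_add, hp]
    have e2 : (n + 1).choose 2 = n + n.choose 2 := by
      rw [show 2 = 1 + 1 from rfl, Nat.choose_succ_succ, Nat.choose_one_right]
    rw [e2]
    congr 2
    omega
  · rw [Finset.sum_eq_zero, smul_zero]
    intro T hT
    apply word_mul_word_eq_zero
    rintro rfl
    rw [Finset.mem_powersetCard] at hT
    exact hp (hT.2.symm.trans hBc)

end Words

/-! ### §5 Size reduction: `ker(fg − c) ≃ ker(gf − c)` for `c ≠ 0` -/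

section SizeReduction

variable {K : Type*} [Field K] {V W : Type*} [AddCommGroup V] [Module K V] [AddCommGroup W] [Module K W]

/-- for `c ≠ 0`, `dim ker(f∘g − c) = dim ker(g∘f − c)`: `g` maps `ker(f∘g − c)` isomorphically onto `ker(g∘f − c)`
(inverse `c⁻¹ • f`) — the non-zero eigenvalues of `fg` and `gf` have the same geometric multiplicities. -/
theorem finrank_ker_comp_sub_smul_comm (f : V →ₗ[K] W) (g : W →ₗ[K] V) {c : K} (hc : c ≠ 0) :
    Module.finrank K (LinearMap.ker (f ∘ₗ g - c • LinearMap.id)) =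
      Module.finrank K (LinearMap.ker (g ∘ₗ f - c • LinearMap.id)) := by
  have key : ∀ {w : W}, w ∈ LinearMap.ker (f ∘ₗ g - c • LinearMap.id) ↔ f (g w) = c • w := fun {w} => by
    rw [LinearMap.mem_ker, LinearMap.sub_apply, LinearMap.comp_apply, LinearMap.smul_apply, LinearMap.id_apply,
      sub_eq_zero]
  have key' : ∀ {v : V}, v ∈ LinearMap.ker (g ∘ₗ f - c • LinearMap.id) ↔ g (f v) = c • v := fun {v} => by
    rw [LinearMap.mem_ker, LinearMap.sub_apply, LinearMap.comp_apply, LinearMap.smul_apply, LinearMap.id_apply,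
      sub_eq_zero]
  refine LinearEquiv.finrank_eq
    { toFun := fun w => ⟨g w.1, key'.mpr (by rw [key.mp w.2, map_smul])⟩
      invFun := fun v => ⟨c⁻¹ • f v.1, key.mpr (by
        rw [map_smul, map_smul, key'.mp v.2, map_smul, smul_smul, smul_smul, inv_mul_cancel₀ hc,
          mul_inv_cancel₀ hc])⟩
      map_add' := fun w w' => by ext; simp
      map_smul' := fun r w => by ext; simp
      left_inv := fun w => by
        apply Subtype.ext
        show c⁻¹ • f (g w.1) = w.1
        rw [key.mp w.2, smul_smul, inv_mul_cancel₀ hc, one_smul]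
      right_inv := fun v => by
        apply Subtype.ext
        show g (c⁻¹ • f v.1) = v.1
        rw [map_smul, key'.mp v.2, smul_smul, inv_mul_cancel₀ hc, one_smul] }

variable {α β : Type*} [Fintype α] [Fintype β] [DecidableEq α] [DecidableEq β]

/-- **size reduction** (proof sheet §4): for matrices `Z : α × β`, `Kq : β × β` and `c ≠ 0`,
`dim ker(Z·Kq·Zᵀ − c) = dim ker(Kq·(ZᵀZ) − c)` — the `2ⁿ × 2ⁿ` block `N = Σ₂Σ₁ = Z K Zᵀ` and the
`(n+1) × (n+1)` matrix `M_f = K·D`, `D = ZᵀZ`, have the same non-zero eigenvalue kernels. -/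
theorem finrank_ker_ZKZt (Z : Matrix α β K) (Kq : Matrix β β K) {c : K} (hc : c ≠ 0) :
    Module.finrank K (LinearMap.ker (Matrix.toLin' (Z * Kq * Z.transpose) - c • LinearMap.id)) =
      Module.finrank K (LinearMap.ker (Matrix.toLin' (Kq * (Z.transpose * Z)) - c • LinearMap.id)) := by
  rw [Matrix.mul_assoc, Matrix.toLin'_mul, ← Matrix.mul_assoc, Matrix.toLin'_mul (Kq * Z.transpose) Z]
  exact finrank_ker_comp_sub_smul_comm _ _ hc

/-- the proof sheet's `D = ZᵀZ = diag C(n,a)` for the size indicator `Z_{B,a} := [|B| = a]` on the subsets `B ⊆ [n]`,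
`a = 0, …, n`: `(ZᵀZ)_{ab} = [a = b] · C(n,a)` (the number of `B ⊆ [n]` with `|B| = a`). -/
theorem transpose_sizeIndicator_mul (n : ℕ) (a b : Fin (n + 1)) :
    ((Matrix.of fun (B : Finset (Fin n)) (a : Fin (n + 1)) => if B.card = (a : ℕ) then (1 : K) else 0).transpose *
        Matrix.of fun (B : Finset (Fin n)) (a : Fin (n + 1)) => if B.card = (a : ℕ) then (1 : K) else 0) a b =
      if a = b then (n.choose a : K) else 0 := by
  simp only [Matrix.mul_apply, Matrix.transpose_apply, Matrix.of_apply]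
  have e : ∀ B : Finset (Fin n), ((if B.card = (a : ℕ) then (1 : K) else 0) * (if B.card = (b : ℕ) then 1 else 0))
      = if (B.card = (a : ℕ) ∧ B.card = (b : ℕ)) then 1 else 0 := by
    intro B
    by_cases ha : B.card = (a : ℕ) <;> by_cases hb : B.card = (b : ℕ) <;> simp [ha, hb]
  simp_rw [e, Finset.sum_boole]
  split_ifs with hab
  · subst hab
    have hf : (Finset.univ.filter fun B : Finset (Fin n) => B.card = (a : ℕ) ∧ B.card = (a : ℕ)) =
        Finset.univ.powersetCard a := by
      rw [Finset.powersetCard_eq_filter, Finset.powerset_univ]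
      exact Finset.filter_congr (fun B _ => and_self_iff)
    rw [hf, Finset.card_powersetCard, Finset.card_univ, Fintype.card_fin]
  · have hf : (Finset.univ.filter fun B : Finset (Fin n) => B.card = (a : ℕ) ∧ B.card = (b : ℕ)) = ∅ :=
      Finset.filter_eq_empty_iff.mpr (fun B _ h => hab (Fin.ext (h.1.symm.trans h.2)))
    rw [hf, Finset.card_empty, Nat.cast_zero]

end SizeReduction

end Summit.Ventures.HSemireg.Mod4Site
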